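import Literature.NumberTheory.Automorphic.HermitianLatticeTreeEulerRelationCongr       -- ★ A-p17 (T4) `natCard_fixedBy_add_eq_natCard_fixedBy_add_one_congr`
import Literature.NumberTheory.Automorphic.HermitianLatticeTreeFlagTransitive          -- ★ B-p04 (g35) p843411 (hI) `forall_flag_exists_latt_eq_of_inert`, `isUnimodular₂_antidiag`
import Literature.NumberTheory.Automorphic.HermitianLatticeTreeTransitive              -- ★ F0P2-p02 (hA)(hB) `…_of_selfDualLocus`, `isModularLattice_latt_of_formCongr_eq_smul`
import Literature.NumberTheory.Automorphic.HermitianLatticeTreeDiagonal                -- ★ `scaleLattice_zpow_latt_one_le_iff`, `latt_mul_diagonal_le_scaleLattice_zpow_latt_one_iff`, `scaleLattice_one`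
import Literature.NumberTheory.Automorphic.UnitaryOrbitalIntegralSimilitudeTransport   -- ★ B-p10 `formCongr_glDiagonal_one_eq_smul_placeForm_antidiag`
import Literature.NumberTheory.Rogawski1990.UnitaryTwoTypeTwoEdgeCount                 -- ★ B-p08 `placeForm_antidiagTwo_eq_antidiag` (+ the inert place API)
import HarnessLib

/-!
# Kottwitz's elliptic relation on `U(Φ₂)(L⁺_v)` at an INERT place, TYPE-BLIND and `2`-FREE: the instance of ★ (T4) at `(Φ₂)_w`

Topic `NumberTheory/Automorphic`, namespace `Literature.NumberTheory.Automorphic.UnitaryGroup` (§2) with generic lattice helpers in `….HermitianLatticeTree` (§1).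
THEOREMS ONLY: no definition, no named fact, no instance, no notation, no `sorry`; kernel lane.  (R2) Euler–Poincaré road for `stub_N6nsR2EP : RankOneEulerPoincareNonsplit`
(assembler B-p14 (g32) ★ p843407 `exists_epRelations_of_ellipticRelation`; LEAD F0P3a-plan (g10) WORDS T9-6∕T9-8): the `hE` binder WITHOUT the type split and WITHOUT
`|2|_w = 1` — so it also serves the unramified places above `2` that the type-(2) road (★ B-p08 p843415) leaves.  Seat B-p08 (g28) (B-p14 09:47:50Z (i): «first
mine takes it»).  HONEST LABEL: HC_CM is proved only modulo the cell's remaining named inputs (hLiu418, h413) until rung 0 closes; nothing printed asserted.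

THE MATHEMATICS (Kottwitz 1988 §2; Serre, *Trees* II.1.1).  ★ A-p17 (T4) `HermitianLatticeTree.natCard_fixedBy_add_eq_natCard_fixedBy_add_one_congr` proves
`#Fix_γ(G⧸C) + #Fix_γ(G⧸C′) = #Fix_γ(G⧸I) + 1` on ANY model `e : G ≃* U(σ, H)` of a unimodular hermitian plane over a discretely valued field, given: a `ϖ`-modular
neighbour `latt g₁` of the root with `ϖL₀ ≤ latt g₁ ≤ L₀`, transitivity of `U` on self-dual lattices (hA), on `ϖ`-modular lattices (hB) and on flags (hI), the three
membership tests for `C, C′, I`, and three finiteness inputs.  THIS FILE instantiates it at an inert place: `E = L_w`, `σ = σ_w`, `H = (Φ₂)_w = antidiag(1,1)`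
(unimodular, ★ `isUnimodular₂_antidiag`), `g₁ = d = diag(1, ϖ)` (`ᵗσ(d)Φ₂d = ϖΦ₂`, ★ B-p10; `ϖ`-modular by ★ `isModularLattice_latt_of_formCongr_eq_smul`; `ϖ𝒪² ≤ d𝒪² ≤ 𝒪²`,
§1), (hA)(hB) from the non-split self-dual locus ★ `exists_mem_unitaryGroupOfForm_mul_of_selfDual_of_nonsplit` through ★ F0P2-p02 `…_of_selfDualLocus`, (hI) from ★ B-p04
`forall_flag_exists_latt_eq_of_inert` with the moved integer `a₀` of an inert place (`|σa₀ − a₀| = 1`, ★ `exists_isUnit_map_sub_of_residueHom_ne`).  The finiteness inputs stay binders (B-p04 (g35) discharges them for regular elliptic `γ` on the locally compact `U₂`).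

* §1 `HermitianLatticeTree.scaleLattice_latt_one_le_latt_diagonal`, `latt_diagonal_le_latt_one` — `ϖ𝒪² ≤ latt diag(1, ϖ) ≤ 𝒪²`.
* §2 **`UnitaryGroup.natCard_fixedBy_add_eq_natCard_fixedBy_add_one_of_finite`** — the inert, type-blind `hE` in ★ (R5c)'s binder shape plus `(hCfin) (hC′fin) (horb)`.
* ED. 2 (EP pen B-p04 (g35) ASK 1): `isModularLattice_latt_glDiagonal_one` (the base edge is `ϖ`-modular at ANY non-split `w`) and the PLACE-BLIND
  **`natCard_fixedBy_add_eq_natCard_fixedBy_add_one_of_transitive`** — the relation modulo `(hA)(hB)(hI)` at `(σ_w, (Φ₂)_w, d)`, inert or ramified, for the tame-ramified corollary.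

## References
* [Kottwitz1988] R. E. Kottwitz, *Tamagawa numbers*, Ann. of Math. 127 (1988), 629–646, §2 Theorem 2.
* [Kottwitz1986] R. E. Kottwitz, *Base change for unit elements of Hecke algebras*, Compositio Math. 60 (1986), §3.
* [Serre1980Trees] J.-P. Serre, *Trees* (1980), I.6.1, II.1.1.
* [Jacobowitz1962] R. Jacobowitz, *Hermitian forms over local fields*, Amer. J. Math. 84 (1962), §7–§8.
-/

set_option autoImplicit false

noncomputable section

open scoped ValuativeRel Matrix MatrixGroups
open Matrix ValuativeRel Finset NumberField IsDedekindDomain MulAction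

/-! ## §1 The base edge `ϖ𝒪² ≤ latt diag(1, ϖ) ≤ 𝒪²` -/

namespace Literature.NumberTheory.Automorphic.HermitianLatticeTree

section BaseEdge

variable {E : Type*} [Field E] [ValuativeRel E] {ϖ : E} (hϖ : IsUniformizingElement ϖ)

include hϖ in
/-- `ϖ · 𝒪² ≤ latt diag(1, ϖ)` (★ `scaleLattice_zpow_latt_one_le_iff` at `P = 1`, exponents `(0, 1)`, `k = 1`). [cite: Serre1980Trees, II.1.1] -/
theorem scaleLattice_latt_one_le_latt_diagonal [IsDiscreteValuationRing 𝒪[E]] :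
    scaleLattice ϖ (latt (1 : Matrix (Fin 2) (Fin 2) E)) ≤ latt (Matrix.diagonal ![(1 : E), ϖ]) := by
  have h := (scaleLattice_zpow_latt_one_le_iff hϖ (1 : GL (Fin 2) E) (one_mem _) 0 1 1).2 ⟨by norm_num, le_rfl⟩
  simpa only [zpow_one, zpow_zero, Units.val_one, Matrix.one_mul] using h

include hϖ in
/-- `latt diag(1, ϖ) ≤ 𝒪²` (★ `latt_mul_diagonal_le_scaleLattice_zpow_latt_one_iff` at `P = 1`, exponents `(0, 1)`, `k = 0`). [cite: Serre1980Trees, II.1.1] -/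
theorem latt_diagonal_le_latt_one [IsDiscreteValuationRing 𝒪[E]] :
    latt (Matrix.diagonal ![(1 : E), ϖ]) ≤ latt (1 : Matrix (Fin 2) (Fin 2) E) := by
  have h := (latt_mul_diagonal_le_scaleLattice_zpow_latt_one_iff hϖ (1 : GL (Fin 2) E) (one_mem _) 0 1 0).2 ⟨le_rfl, by norm_num⟩
  simpa only [zpow_one, zpow_zero, Units.val_one, Matrix.one_mul, scaleLattice_one] using h

end BaseEdge

end Literature.NumberTheory.Automorphic.HermitianLatticeTree

/-! ## §2 The inert, type-blind elliptic relation on `U₂` -/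

namespace Literature.NumberTheory.Automorphic.UnitaryGroup

open Literature.NumberTheory.Automorphic.HermitianLatticeTree

section CM

variable (L : Type) [Field L] [NumberField L] [IsCMField L] (v : HeightOneSpectrum (𝓞 ↥(maximalRealSubfield L)))
  (w : PlacesOver L v) (hw : IsCMField.complexConj L • w.1 = w.1)

omit [IsCMField L] in
/-- `↑(glDiagonal ![1, ϖ]) = diagonal ![1, ↑ϖ]`. [cite: Serre1980Trees, II.1.1] -/
private theorem coe_glDiagonal_one_unit (ϖ : (w.1.adicCompletion L)ˣ) :
    ((glDiagonal 2 (w.1.adicCompletion L) ![1, ϖ] : GL (Fin 2) (w.1.adicCompletion L)) : Matrix (Fin 2) (Fin 2) (w.1.adicCompletion L)) = Matrix.diagonal ![(1 : (w.1.adicCompletion L)), (ϖ : (w.1.adicCompletion L))] := by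
  rw [coe_glDiagonal]
  congr 1
  funext i
  fin_cases i <;> rfl

include hw in
/-- **KOTTWITZ'S ELLIPTIC RELATION `V_C + V_{C′} = E + 1` ON `U₂` AT AN INERT PLACE — TYPE-BLIND, `2`-FREE** (★ A-p17 (T4) at `(Φ₂)_w`).  At a finite place `v` unramified and
non-split in `L`, with `ϖ ∈ L_w^×` a `σ_w`-fixed uniformiser, for subgroups `C, C′, I ≤ U₂` characterised at `w` by `GL₂(𝒪_w)`, `d GL₂(𝒪_w) d⁻¹` (`d = diag(1, ϖ)`) and
`I = C ∩ C′`, and for EVERY `γ ∈ U₂` whose fixed sets in `U₂ ⧸ C`, `U₂ ⧸ C′` and whose `⟨γ⟩`-orbit of the base coset are finite (true for regular elliptic `γ`):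
`#Fix(U₂ ⧸ C, γ) + #Fix(U₂ ⧸ C′, γ) = #Fix(U₂ ⧸ I, γ) + 1`.  No type split, no hypothesis on the residue characteristic.
[cite: Kottwitz1988, §2 Theorem 2] [cite: Kottwitz1986, §3] [cite: Serre1980Trees, I.6.1, II.1.1] -/
theorem natCard_fixedBy_add_eq_natCard_fixedBy_add_one_of_finite (hunr : Algebra.IsUnramifiedIn (𝓞 L) v.asIdeal)
    (ϖ : (w.1.adicCompletion L)ˣ) (hϖ : Valued.v (ϖ : (w.1.adicCompletion L)) = WithZero.exp (-1 : ℤ))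
    (hσϖ : (galAdicCompletionMap (L := L) (IsCMField.complexConj L) hw) (ϖ : (w.1.adicCompletion L)) = ϖ)
    (C C' I : Subgroup ((cmDatum L 2 (Matrix.of fun i j : Fin 2 => if i.val + j.val + 1 = 2 then (1 : L) else 0)).Local v))
    (hC : ∀ g, g ∈ C ↔ (((localNonsplitEquiv (IsCMField.complexConj L) (Matrix.of fun i j : Fin 2 => if i.val + j.val + 1 = 2 then (1 : L) else 0) (IsCMField.complexConj_ne_one L) w hw) g : ↥(unitaryGroupOfForm (galAdicCompletionMap (L := L) (IsCMField.complexConj L) hw) (placeForm (Matrix.of fun i j : Fin 2 => if i.val + j.val + 1 = 2 then (1 : L) else 0) w.1))) : GL (Fin 2) (w.1.adicCompletion L)) ∈ glInt 2 (w.1.adicCompletion L))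
    (hC' : ∀ g, g ∈ C' ↔ (((localNonsplitEquiv (IsCMField.complexConj L) (Matrix.of fun i j : Fin 2 => if i.val + j.val + 1 = 2 then (1 : L) else 0) (IsCMField.complexConj_ne_one L) w hw) g : ↥(unitaryGroupOfForm (galAdicCompletionMap (L := L) (IsCMField.complexConj L) hw) (placeForm (Matrix.of fun i j : Fin 2 => if i.val + j.val + 1 = 2 then (1 : L) else 0) w.1))) : GL (Fin 2) (w.1.adicCompletion L)) ∈ (glInt 2 (w.1.adicCompletion L)).map (MulAut.conj (glDiagonal 2 (w.1.adicCompletion L) ![1, ϖ])).toMonoidHom)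
    (hI' : ∀ g, g ∈ I ↔ g ∈ C ∧ g ∈ C')
    (γ : ((cmDatum L 2 (Matrix.of fun i j : Fin 2 => if i.val + j.val + 1 = 2 then (1 : L) else 0)).Local v)) (hCfin : (fixedBy (((cmDatum L 2 (Matrix.of fun i j : Fin 2 => if i.val + j.val + 1 = 2 then (1 : L) else 0)).Local v) ⧸ C) γ).Finite) (hC'fin : (fixedBy (((cmDatum L 2 (Matrix.of fun i j : Fin 2 => if i.val + j.val + 1 = 2 then (1 : L) else 0)).Local v) ⧸ C') γ).Finite)
    (horb : (Set.range fun n : ℕ => ((γ ^ n : ((cmDatum L 2 (Matrix.of fun i j : Fin 2 => if i.val + j.val + 1 = 2 then (1 : L) else 0)).Local v)) : ((cmDatum L 2 (Matrix.of fun i j : Fin 2 => if i.val + j.val + 1 = 2 then (1 : L) else 0)).Local v) ⧸ C)).Finite) :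
    Nat.card (fixedBy (((cmDatum L 2 (Matrix.of fun i j : Fin 2 => if i.val + j.val + 1 = 2 then (1 : L) else 0)).Local v) ⧸ C) γ) + Nat.card (fixedBy (((cmDatum L 2 (Matrix.of fun i j : Fin 2 => if i.val + j.val + 1 = 2 then (1 : L) else 0)).Local v) ⧸ C') γ) = Nat.card (fixedBy (((cmDatum L 2 (Matrix.of fun i j : Fin 2 => if i.val + j.val + 1 = 2 then (1 : L) else 0)).Local v) ⧸ I) γ) + 1 := by
  classical
  have hc1 : IsCMField.complexConj L ≠ 1 := IsCMField.complexConj_ne_one L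
  -- the place: uniformizer, DVR, `σ_w` data
  have hϖ' : IsUniformizingElement (ϖ : (w.1.adicCompletion L)) := isUniformizingElement_of_v_eq hϖ
  haveI : IsDiscreteValuationRing 𝒪[(w.1.adicCompletion L)] := isDiscreteValuationRing_integer_of_compatible hϖ
  have hσv : ∀ x, valuation (w.1.adicCompletion L) ((galAdicCompletionMap (L := L) (IsCMField.complexConj L) hw) x) = valuation (w.1.adicCompletion L) x := fun x => valuation_galAdicCompletionMap_eq (IsCMField.complexConj L) v w hw x
  have hσσ : ∀ x, (galAdicCompletionMap (L := L) (IsCMField.complexConj L) hw) ((galAdicCompletionMap (L := L) (IsCMField.complexConj L) hw) x) = x := galAdicCompletionMap_galAdicCompletionMap_of_smul_eq (IsCMField.complexConj L) w hc1 hw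
  have hσO : ∀ x : 𝒪[(w.1.adicCompletion L)], (galAdicCompletionMap (L := L) (IsCMField.complexConj L) hw) x ∈ 𝒪[(w.1.adicCompletion L)] := mem_integer_galAdicCompletionMap (IsCMField.complexConj L) v w hw
  -- the form `(Φ₂)_w = antidiag(1,1)`: unimodular, hermitian, in `GL₂(𝒪)`
  have hH2 : placeForm (Matrix.of fun i j : Fin 2 => if i.val + j.val + 1 = 2 then (1 : L) else 0) w.1 = (!![0, 1; 1, 0] : Matrix (Fin 2) (Fin 2) (w.1.adicCompletion L)) := placeForm_antidiagTwo_eq_antidiag L v w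
  have hHuni : IsUnimodular₂ (placeForm (Matrix.of fun i j : Fin 2 => if i.val + j.val + 1 = 2 then (1 : L) else 0) w.1) := by
    rw [hH2]; exact isUnimodular₂_antidiag
  have hJi := unit_placeForm_antidiagOne_mem_glInt (E := L) 2 w.1
  have hJh : ((((isUnit_placeForm_antidiagOne (E := L) 2 w.1).unit : GL (Fin 2) (w.1.adicCompletion L)) : Matrix (Fin 2) (Fin 2) (w.1.adicCompletion L)).map (galAdicCompletionMap (L := L) (IsCMField.complexConj L) hw))ᵀ =
      (isUnit_placeForm_antidiagOne (E := L) 2 w.1).unit :=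
    placeForm_hermitian_of_smul_eq (IsCMField.complexConj L) w (Matrix.of fun i j : Fin 2 => if i.val + j.val + 1 = 2 then (1 : L) else 0) (by
      rw [← map_cmConjRingHom_eq_map_complexConj]; exact antidiagOne_isHermitian L 2) hw
  -- the self-dual locus at a non-split place ⇒ (hA), (hB)
  have hsd := exists_mem_unitaryGroupOfForm_mul_of_selfDual_of_nonsplit (IsCMField.complexConj L) w hc1 hw hunr
    (isUnit_placeForm_antidiagOne (E := L) 2 w.1).unit hJi hJh
  have hform := formCongr_glDiagonal_one_eq_smul_placeForm_antidiag L w hw ϖ hσϖ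
  have hA := forall_isSelfDualLattice_exists_latt_eq_of_selfDualLocus (galAdicCompletionMap (L := L) (IsCMField.complexConj L) hw) (placeForm (Matrix.of fun i j : Fin 2 => if i.val + j.val + 1 = 2 then (1 : L) else 0) w.1) hsd
  have hB := forall_isModularLattice_exists_latt_mul_eq_of_selfDualLocus (galAdicCompletionMap (L := L) (IsCMField.complexConj L) hw) (placeForm (Matrix.of fun i j : Fin 2 => if i.val + j.val + 1 = 2 then (1 : L) else 0) w.1) ϖ.ne_zero
    (glDiagonal 2 (w.1.adicCompletion L) ![1, ϖ]) hform hsd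
  -- the base edge `d = diag(1, ϖ)`
  have hd := coe_glDiagonal_one_unit L v w ϖ
  have hg₁ : IsModularLattice (galAdicCompletionMap (L := L) (IsCMField.complexConj L) hw) (ϖ : (w.1.adicCompletion L)) (placeForm (Matrix.of fun i j : Fin 2 => if i.val + j.val + 1 = 2 then (1 : L) else 0) w.1)
      (latt ((glDiagonal 2 (w.1.adicCompletion L) ![1, ϖ] : GL (Fin 2) (w.1.adicCompletion L)) : Matrix (Fin 2) (Fin 2) (w.1.adicCompletion L))) :=
    isModularLattice_latt_of_formCongr_eq_smul (galAdicCompletionMap (L := L) (IsCMField.complexConj L) hw) (isUnit_placeForm_antidiagOne (E := L) 2 w.1).unit hJi ϖ.ne_zero _ hform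
  have hadj₁ : scaleLattice (ϖ : (w.1.adicCompletion L)) (latt (1 : Matrix (Fin 2) (Fin 2) (w.1.adicCompletion L))) ≤
      latt ((glDiagonal 2 (w.1.adicCompletion L) ![1, ϖ] : GL (Fin 2) (w.1.adicCompletion L)) : Matrix (Fin 2) (Fin 2) (w.1.adicCompletion L)) := by
    rw [hd]; exact scaleLattice_latt_one_le_latt_diagonal hϖ'
  have hadj₂ : latt ((glDiagonal 2 (w.1.adicCompletion L) ![1, ϖ] : GL (Fin 2) (w.1.adicCompletion L)) : Matrix (Fin 2) (Fin 2) (w.1.adicCompletion L)) ≤ latt (1 : Matrix (Fin 2) (Fin 2) (w.1.adicCompletion L)) := by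
    rw [hd]; exact latt_diagonal_le_latt_one hϖ'
  -- (hI): flag transitivity from the moved integer of an inert place
  obtain ⟨σk, hσk⟩ := exists_residueField_ringHom_galAdicCompletionMap (IsCMField.complexConj L) v w hw
  letI : Fintype 𝓀[(w.1.adicCompletion L)] := Fintype.ofFinite _
  have hq' : Fintype.card 𝓀[(w.1.adicCompletion L)] = Nat.card (𝓞 ↥(maximalRealSubfield L) ⧸ v.asIdeal) ^ 2 := by
    rw [← Nat.card_eq_fintype_card]; exact natCard_residueField_eq_sq_of_inert (IsCMField.complexConj L) v hc1 hunr w hw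
  obtain ⟨a₀, ha₀⟩ := LocalFields.UnramifiedQuadraticNorm.exists_isUnit_map_sub_of_residueHom_ne (galAdicCompletionMap (L := L) (IsCMField.complexConj L) hw) hσO σk hσk
    (Literature.LinearAlgebra.Matrix.exists_frob_ne hq' σk (residueHom_galAdicCompletionMap_eq_pow (IsCMField.complexConj L) v hc1 hunr w hw σk hσO hσk))
  have ha₀u : valuation (w.1.adicCompletion L) ((galAdicCompletionMap (L := L) (IsCMField.complexConj L) hw) (a₀ : (w.1.adicCompletion L)) - a₀) = 1 :=
    ((Valuation.integer.integers (valuation (w.1.adicCompletion L))).isUnit_iff_valuation_eq_one).1 ha₀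
  have hI := forall_flag_exists_latt_eq_of_inert (galAdicCompletionMap (L := L) (IsCMField.complexConj L) hw) hσσ hσv hϖ' a₀.2 ha₀u hH2 (glDiagonal 2 (w.1.adicCompletion L) ![1, ϖ]) hd hA
  -- ★ (T4)
  exact HermitianLatticeTree.natCard_fixedBy_add_eq_natCard_fixedBy_add_one_congr (galAdicCompletionMap (L := L) (IsCMField.complexConj L) hw) hσv hϖ' hHuni (localNonsplitEquiv (IsCMField.complexConj L) (Matrix.of fun i j : Fin 2 => if i.val + j.val + 1 = 2 then (1 : L) else 0) (IsCMField.complexConj_ne_one L) w hw).toMulEquiv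
    (glDiagonal 2 (w.1.adicCompletion L) ![1, ϖ]) hg₁ hadj₁ hadj₂ hA hB hI C C' I hC hC' hI' γ hCfin hC'fin horb

include hw in
/-- **The base edge `d = diag(1, ϖ)` is `ϖ`-modular for `(Φ₂)_w` at ANY non-split place** (inert or ramified; no `σ_w ϖ = ϖ` needed):
`ϖ⁻¹ · ᵗσ(d) Φ₂ d = !![0, 1; σ(ϖ)∕ϖ, 0]` is unimodular since `|σ_w ϖ| = |ϖ|`. [cite: Jacobowitz1962, §8] [cite: Serre1980Trees, II.1.1] -/
theorem isModularLattice_latt_glDiagonal_one (ϖ : (w.1.adicCompletion L)ˣ) :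
    IsModularLattice (galAdicCompletionMap (L := L) (IsCMField.complexConj L) hw) (ϖ : (w.1.adicCompletion L)) (placeForm (Matrix.of fun i j : Fin 2 => if i.val + j.val + 1 = 2 then (1 : L) else 0) w.1) (latt (((glDiagonal 2 (w.1.adicCompletion L) ![1, ϖ]) : GL (Fin 2) (w.1.adicCompletion L)) : Matrix (Fin 2) (Fin 2) (w.1.adicCompletion L))) := by
  have hσv : ∀ x, valuation (w.1.adicCompletion L) ((galAdicCompletionMap (L := L) (IsCMField.complexConj L) hw) x) = valuation (w.1.adicCompletion L) x := fun x => valuation_galAdicCompletionMap_eq (IsCMField.complexConj L) v w hw x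
  have hH2 : placeForm (Matrix.of fun i j : Fin 2 => if i.val + j.val + 1 = 2 then (1 : L) else 0) w.1 = (!![0, 1; 1, 0] : Matrix (Fin 2) (Fin 2) (w.1.adicCompletion L)) := placeForm_antidiagTwo_eq_antidiag L v w
  have hd := coe_glDiagonal_one_unit L v w ϖ
  have h0 : (ϖ : (w.1.adicCompletion L)) ≠ 0 := ϖ.ne_zero
  refine ⟨(glDiagonal 2 (w.1.adicCompletion L) ![1, ϖ]), rfl, ?_⟩
  -- the rescaled Gram matrix `ϖ⁻¹ · ᵗσ(d) Φ₂ d = !![0, 1; σϖ∕ϖ, 0]`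
  have hG : (ϖ : (w.1.adicCompletion L))⁻¹ • formCongr (galAdicCompletionMap (L := L) (IsCMField.complexConj L) hw) (glDiagonal 2 (w.1.adicCompletion L) ![1, ϖ]) (placeForm (Matrix.of fun i j : Fin 2 => if i.val + j.val + 1 = 2 then (1 : L) else 0) w.1) =
      !![0, 1; (ϖ : (w.1.adicCompletion L))⁻¹ * (galAdicCompletionMap (L := L) (IsCMField.complexConj L) hw) (ϖ : (w.1.adicCompletion L)), 0] := by
    rw [formCongr, hH2, hd, Matrix.diagonal_map (map_zero _), Matrix.diagonal_transpose]
    ext i j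
    fin_cases i <;> fin_cases j <;> simp [Matrix.mul_apply, Matrix.diagonal]
  have hu : valuation (w.1.adicCompletion L) ((ϖ : (w.1.adicCompletion L))⁻¹ * (galAdicCompletionMap (L := L) (IsCMField.complexConj L) hw) (ϖ : (w.1.adicCompletion L))) = 1 := by
    rw [map_mul, map_inv₀, hσv, inv_mul_cancel₀ ((Valuation.ne_zero_iff _).2 h0)]
  rw [hG]
  refine ⟨fun i j => ?_, ?_⟩
  · fin_cases i <;> fin_cases j
    · simp
    · simp [one_mem]
    · simpa using (Valuation.mem_integer_iff _ _).2 hu.le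
    · simp
  · rw [Matrix.det_fin_two_of, zero_mul, zero_sub, Valuation.map_neg, one_mul, hu]

include hw in
/-- **KOTTWITZ'S ELLIPTIC RELATION ON `U₂`, PLACE-BLIND, MODULO THE THREE TRANSITIVITIES** (EP pen B-p04 (g35) ASK 1, 09:55:52Z): at ANY non-split place `w ∣ v` (inert OR
ramified; no `σ_w ϖ = ϖ`, no `|2| = 1`, no unramifiedness), for `ϖ ∈ L_w^×` a uniformiser (`|ϖ| = exp(−1)`), subgroups `C, C′, I ≤ U₂` characterised at `w` by `GL₂(𝒪_w)`,
`d GL₂(𝒪_w) d⁻¹` (`d = diag(1, ϖ)`) and `I = C ∩ C′`, the three transitivities of `U(σ_w, (Φ₂)_w)` — on self-dual lattices (hA), on `ϖ`-modular lattices through `d`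
(hB), on flags through `d` (hI) — and the three finiteness inputs for `γ ∈ U₂`: `#Fix(U₂ ⧸ C, γ) + #Fix(U₂ ⧸ C′, γ) = #Fix(U₂ ⧸ I, γ) + 1`.  Discharged inside: `(Φ₂)_w`
unimodular (★ `isUnimodular₂_antidiag`), `latt d` `ϖ`-modular (`isModularLattice_latt_glDiagonal_one`), `ϖ𝒪² ≤ latt d ≤ 𝒪²` (§1); then ★ (T4).  The INERT corollary is
`…_of_finite` above ((hA)(hB)(hI) from the non-split self-dual locus + ★ (hI)-inert); the TAME-RAMIFIED corollary takes A-p06 (g27)'s ramified (hA)(hB)(hI) (B-p04 (g35) pen).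
[cite: Kottwitz1988, §2 Theorem 2] [cite: Kottwitz1986, §3] [cite: Serre1980Trees, I.6.1, II.1.1] -/
theorem natCard_fixedBy_add_eq_natCard_fixedBy_add_one_of_transitive
    (ϖ : (w.1.adicCompletion L)ˣ) (hϖ : Valued.v (ϖ : (w.1.adicCompletion L)) = WithZero.exp (-1 : ℤ))
    (C C' I : Subgroup ((cmDatum L 2 (Matrix.of fun i j : Fin 2 => if i.val + j.val + 1 = 2 then (1 : L) else 0)).Local v))
    (hC : ∀ g, g ∈ C ↔ (((localNonsplitEquiv (IsCMField.complexConj L) (Matrix.of fun i j : Fin 2 => if i.val + j.val + 1 = 2 then (1 : L) else 0) (IsCMField.complexConj_ne_one L) w hw) g : ↥(unitaryGroupOfForm (galAdicCompletionMap (L := L) (IsCMField.complexConj L) hw) (placeForm (Matrix.of fun i j : Fin 2 => if i.val + j.val + 1 = 2 then (1 : L) else 0) w.1))) : GL (Fin 2) (w.1.adicCompletion L)) ∈ glInt 2 (w.1.adicCompletion L))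
    (hC' : ∀ g, g ∈ C' ↔ (((localNonsplitEquiv (IsCMField.complexConj L) (Matrix.of fun i j : Fin 2 => if i.val + j.val + 1 = 2 then (1 : L) else 0) (IsCMField.complexConj_ne_one L) w hw) g : ↥(unitaryGroupOfForm (galAdicCompletionMap (L := L) (IsCMField.complexConj L) hw) (placeForm (Matrix.of fun i j : Fin 2 => if i.val + j.val + 1 = 2 then (1 : L) else 0) w.1))) : GL (Fin 2) (w.1.adicCompletion L)) ∈ (glInt 2 (w.1.adicCompletion L)).map (MulAut.conj (glDiagonal 2 (w.1.adicCompletion L) ![1, ϖ])).toMonoidHom)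
    (hI' : ∀ g, g ∈ I ↔ g ∈ C ∧ g ∈ C')
    (hA : ∀ M : Submodule 𝒪[(w.1.adicCompletion L)] (Fin 2 → (w.1.adicCompletion L)), IsSelfDualLattice (galAdicCompletionMap (L := L) (IsCMField.complexConj L) hw) (placeForm (Matrix.of fun i j : Fin 2 => if i.val + j.val + 1 = 2 then (1 : L) else 0) w.1) M →
      ∃ u : ↥(unitaryGroupOfForm (galAdicCompletionMap (L := L) (IsCMField.complexConj L) hw) (placeForm (Matrix.of fun i j : Fin 2 => if i.val + j.val + 1 = 2 then (1 : L) else 0) w.1)), latt (((u : GL (Fin 2) (w.1.adicCompletion L))) : Matrix (Fin 2) (Fin 2) (w.1.adicCompletion L)) = M)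
    (hB : ∀ M : Submodule 𝒪[(w.1.adicCompletion L)] (Fin 2 → (w.1.adicCompletion L)), IsModularLattice (galAdicCompletionMap (L := L) (IsCMField.complexConj L) hw) (ϖ : (w.1.adicCompletion L)) (placeForm (Matrix.of fun i j : Fin 2 => if i.val + j.val + 1 = 2 then (1 : L) else 0) w.1) M →
      ∃ u : ↥(unitaryGroupOfForm (galAdicCompletionMap (L := L) (IsCMField.complexConj L) hw) (placeForm (Matrix.of fun i j : Fin 2 => if i.val + j.val + 1 = 2 then (1 : L) else 0) w.1)), latt (((u : GL (Fin 2) (w.1.adicCompletion L)) * (glDiagonal 2 (w.1.adicCompletion L) ![1, ϖ]) : GL (Fin 2) (w.1.adicCompletion L)) : Matrix (Fin 2) (Fin 2) (w.1.adicCompletion L)) = M)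
    (hI : ∀ M N : Submodule 𝒪[(w.1.adicCompletion L)] (Fin 2 → (w.1.adicCompletion L)), IsSelfDualLattice (galAdicCompletionMap (L := L) (IsCMField.complexConj L) hw) (placeForm (Matrix.of fun i j : Fin 2 => if i.val + j.val + 1 = 2 then (1 : L) else 0) w.1) M →
      IsModularLattice (galAdicCompletionMap (L := L) (IsCMField.complexConj L) hw) (ϖ : (w.1.adicCompletion L)) (placeForm (Matrix.of fun i j : Fin 2 => if i.val + j.val + 1 = 2 then (1 : L) else 0) w.1) N → scaleLattice (ϖ : (w.1.adicCompletion L)) M ≤ N → N ≤ M →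
      ∃ u : ↥(unitaryGroupOfForm (galAdicCompletionMap (L := L) (IsCMField.complexConj L) hw) (placeForm (Matrix.of fun i j : Fin 2 => if i.val + j.val + 1 = 2 then (1 : L) else 0) w.1)), latt (((u : GL (Fin 2) (w.1.adicCompletion L))) : Matrix (Fin 2) (Fin 2) (w.1.adicCompletion L)) = M ∧
        latt (((u : GL (Fin 2) (w.1.adicCompletion L)) * (glDiagonal 2 (w.1.adicCompletion L) ![1, ϖ]) : GL (Fin 2) (w.1.adicCompletion L)) : Matrix (Fin 2) (Fin 2) (w.1.adicCompletion L)) = N)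
    (γ : ((cmDatum L 2 (Matrix.of fun i j : Fin 2 => if i.val + j.val + 1 = 2 then (1 : L) else 0)).Local v)) (hCfin : (fixedBy (((cmDatum L 2 (Matrix.of fun i j : Fin 2 => if i.val + j.val + 1 = 2 then (1 : L) else 0)).Local v) ⧸ C) γ).Finite) (hC'fin : (fixedBy (((cmDatum L 2 (Matrix.of fun i j : Fin 2 => if i.val + j.val + 1 = 2 then (1 : L) else 0)).Local v) ⧸ C') γ).Finite)
    (horb : (Set.range fun n : ℕ => ((γ ^ n : ((cmDatum L 2 (Matrix.of fun i j : Fin 2 => if i.val + j.val + 1 = 2 then (1 : L) else 0)).Local v)) : ((cmDatum L 2 (Matrix.of fun i j : Fin 2 => if i.val + j.val + 1 = 2 then (1 : L) else 0)).Local v) ⧸ C)).Finite) :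
    Nat.card (fixedBy (((cmDatum L 2 (Matrix.of fun i j : Fin 2 => if i.val + j.val + 1 = 2 then (1 : L) else 0)).Local v) ⧸ C) γ) + Nat.card (fixedBy (((cmDatum L 2 (Matrix.of fun i j : Fin 2 => if i.val + j.val + 1 = 2 then (1 : L) else 0)).Local v) ⧸ C') γ) = Nat.card (fixedBy (((cmDatum L 2 (Matrix.of fun i j : Fin 2 => if i.val + j.val + 1 = 2 then (1 : L) else 0)).Local v) ⧸ I) γ) + 1 := by
  classical
  have hϖ' : IsUniformizingElement (ϖ : (w.1.adicCompletion L)) := isUniformizingElement_of_v_eq hϖ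
  haveI : IsDiscreteValuationRing 𝒪[(w.1.adicCompletion L)] := isDiscreteValuationRing_integer_of_compatible hϖ
  have hσv : ∀ x, valuation (w.1.adicCompletion L) ((galAdicCompletionMap (L := L) (IsCMField.complexConj L) hw) x) = valuation (w.1.adicCompletion L) x := fun x => valuation_galAdicCompletionMap_eq (IsCMField.complexConj L) v w hw x
  have hH2 : placeForm (Matrix.of fun i j : Fin 2 => if i.val + j.val + 1 = 2 then (1 : L) else 0) w.1 = (!![0, 1; 1, 0] : Matrix (Fin 2) (Fin 2) (w.1.adicCompletion L)) := placeForm_antidiagTwo_eq_antidiag L v w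
  have hHuni : IsUnimodular₂ (placeForm (Matrix.of fun i j : Fin 2 => if i.val + j.val + 1 = 2 then (1 : L) else 0) w.1) := by
    rw [hH2]; exact isUnimodular₂_antidiag
  have hd := coe_glDiagonal_one_unit L v w ϖ
  have hg₁ := isModularLattice_latt_glDiagonal_one L v w hw ϖ
  have hadj₁ : scaleLattice (ϖ : (w.1.adicCompletion L)) (latt (1 : Matrix (Fin 2) (Fin 2) (w.1.adicCompletion L))) ≤ latt (((glDiagonal 2 (w.1.adicCompletion L) ![1, ϖ]) : GL (Fin 2) (w.1.adicCompletion L)) : Matrix (Fin 2) (Fin 2) (w.1.adicCompletion L)) := by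
    rw [hd]; exact scaleLattice_latt_one_le_latt_diagonal hϖ'
  have hadj₂ : latt (((glDiagonal 2 (w.1.adicCompletion L) ![1, ϖ]) : GL (Fin 2) (w.1.adicCompletion L)) : Matrix (Fin 2) (Fin 2) (w.1.adicCompletion L)) ≤ latt (1 : Matrix (Fin 2) (Fin 2) (w.1.adicCompletion L)) := by
    rw [hd]; exact latt_diagonal_le_latt_one hϖ'
  exact HermitianLatticeTree.natCard_fixedBy_add_eq_natCard_fixedBy_add_one_congr (galAdicCompletionMap (L := L) (IsCMField.complexConj L) hw) hσv hϖ' hHuni (localNonsplitEquiv (IsCMField.complexConj L) (Matrix.of fun i j : Fin 2 => if i.val + j.val + 1 = 2 then (1 : L) else 0) (IsCMField.complexConj_ne_one L) w hw).toMulEquiv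
    (glDiagonal 2 (w.1.adicCompletion L) ![1, ϖ]) hg₁ hadj₁ hadj₂ hA hB hI C C' I hC hC' hI' γ hCfin hC'fin horb

end CM

end Literature.NumberTheory.Automorphic.UnitaryGroup

end
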